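import Literature.AlgebraicGeometry.HodgeTheory.AlgebraicChartHodgeModel
import Literature.AlgebraicGeometry.HodgeTheory.BettiUniverseTraceIntegral
import HarnessLib

/-!
# The complex orientation of `X(ℂ)` in the algebraic charts integrates a closed top form non-trivially

Family `hodge`, layer `Literature/AlgebraicGeometry/HodgeTheory`. Theorems only; no definition, no named
fact. Written by the prover seat `hodge-nonav-prover-Ax` (g12, cell `hodge-nonav`) as a prerequisite of
brick FF4 of the programme «GRIFFITHS-SURFACES / B4 RELATIVE RESIDUES».

The flat-coordinate theorem `dual_eq_sum_mul_cintegral_of_continuation` (`HolonomyFlatCoordinates`)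
and the trace comparison `BettiUniverse.exists_trC_eq_mul_cintegral` take, on the carrier of a Hodge
model, a continuous orientation `o` together with a closed complex top form of non-zero integral
(hypothesis `hI`). For the model `algebraicModel hX` of a smooth projective `X` — carrier `X(ℂ)` with
Serre's holomorphic algebraic charts, model space `ℂⁿ` — this is supplied here
(`exists_orientation_cintegral_ne_zero_algebraicChart`): `X(ℂ)` is Kähler in these charts (pull-back
of Fubini–Study along a projective embedding, the tree's
`isKaehlerManifold_of_isAnalytification_of_isClosedImmersion_holds`), the complex orientation is
continuous and `∫_{X(ℂ)} ωⁿ > 0` (Voisin I §3.1.3 Lemma 3.8, the tree's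
`exists_orientation_integral_kaehlerFormPow_pos`), and `ωⁿ` is closed
(`kaehlerFormPow_mem_closedSmoothForms`). Same proof as
`KaehlerRationalDatum.exists_orientation_cintegral_ne_zero`, for the algebraic-chart model instead of a
Kähler–rational datum.

## References

* [VoisinHodgeI2002] C. Voisin, Hodge Theory and Complex Algebraic Geometry I (2002), §3.1.3 Lemma 3.8,
  §3.3.2 Lemma 3.16.
* [SerreGAGA1956] J.-P. Serre, GAGA, Ann. Inst. Fourier 6 (1956), §2 n°5 Prop. 2.
-/

noncomputable section

open scoped Manifold ContDiff
open CategoryTheory AlgebraicGeometry Module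
open Literature.Geometry.Kaehler Literature.NumberTheory.Transcendental
open Literature.AlgebraicGeometry.Motives

namespace Literature.AlgebraicGeometry.HodgeTheory

variable {n : ℕ} {X : Motives.SchemeOver ℂ}

/-- **The complex orientation of `X(ℂ)` in the algebraic charts integrates `ωⁿ` non-trivially.** For
`X` smooth projective of dimension `n`, on `X(ℂ)` with the atlas of holomorphic algebraic charts (the
carrier of `algebraicModel hX`, installed by `letI`) there are, in top degree `m = 2n`, a constant
continuous orientation `o₀` and a closed complex top form with `∫ ≠ 0` — the hypothesis `hI` of
`BettiUniverse.exists_trC_eq_mul_cintegral` / `dual_eq_sum_mul_cintegral_of_continuation` for this model.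
[cite: VoisinHodgeI2002, §3.1.3 Lemma 3.8 and §3.3.2 Lemma 3.16] [cite: SerreGAGA1956, §2 n°5 Prop. 2] -/
theorem exists_orientation_cintegral_ne_zero_algebraicChart (hX : Motives.IsSmoothProjective n X)
    {m : ℕ} (hm : m = 2 * n) [Fact (finrank ℝ (Fin n → ℂ) = m)] :
    letI : ChartedSpace (Fin n → ℂ) (ComplexPoints X) := (algebraicModel hX).chartedSpace
    haveI : T2Space (ComplexPoints X) := Motives.ComplexPoints.t2Space_of_isSmoothProjective hX
    haveI : SigmaCompactSpace (ComplexPoints X) := (algebraicModel hX).sigmaCompactSpace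
    haveI : IsManifold 𝓘(ℝ, Fin n → ℂ) ∞ (ComplexPoints X) := (algebraicModel hX).isManifold_real
    ∃ o₀ : Orientation ℝ (Fin n → ℂ) (Fin m),
      IsContinuousOrientation (I := 𝓘(ℝ, Fin n → ℂ)) (M := ComplexPoints X) (fun _ ↦ o₀) ∧
        ∃ F : cclosedSmoothForms (Fin n → ℂ) (ComplexPoints X) m,
          cintegral (fun _ : ComplexPoints X ↦ o₀) (F : MForm 𝓘(ℝ, Fin n → ℂ) (ComplexPoints X) ℂ m) ≠ 0 := by
  letI : ChartedSpace (Fin n → ℂ) (ComplexPoints X) := (algebraicModel hX).chartedSpace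
  haveI : T2Space (ComplexPoints X) := Motives.ComplexPoints.t2Space_of_isSmoothProjective hX
  haveI : SigmaCompactSpace (ComplexPoints X) := (algebraicModel hX).sigmaCompactSpace
  haveI : IsManifold 𝓘(ℂ, Fin n → ℂ) ω (ComplexPoints X) := (algebraicModel hX).isManifold
  haveI : IsManifold 𝓘(ℝ, Fin n → ℂ) ∞ (ComplexPoints X) := (algebraicModel hX).isManifold_real
  haveI : CompactSpace (ComplexPoints X) := Motives.ComplexPoints.compactSpace_of_isSmoothProjective hX
  haveI : Nonempty (ComplexPoints X) := (algebraicModel hX).nonempty_carrier hX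
  subst hm
  -- `X(ℂ)` is Kähler in the algebraic charts (pull-back of Fubini–Study)
  haveI := hX.smoothOfRelativeDimension
  haveI : Smooth X.hom := SmoothOfRelativeDimension.smooth n _
  haveI : LocallyOfFiniteType X.hom := inferInstance
  obtain ⟨N, ι, hι⟩ := hX.isProjectiveOver
  haveI := hι
  haveI : IsKaehlerManifold (Fin n → ℂ) (ComplexPoints X) :=
    Motives.isKaehlerManifold_of_isAnalytification_of_isClosedImmersion_holds ι
      (Motives.isAnalytification_algebraicChart X n)
  obtain ⟨g, hg⟩ := IsKaehlerManifold.exists_isKaehler (E := Fin n → ℂ) (M := ComplexPoints X)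
  -- work in the free dimension `d = dim_ℂ ℂⁿ`, then specialise `d = n`
  suffices h : ∀ {d : ℕ} (hd : finrank ℂ (Fin n → ℂ) = d) [Fact (finrank ℝ (Fin n → ℂ) = 2 * d)],
      ∃ o₀ : Orientation ℝ (Fin n → ℂ) (Fin (2 * d)),
        IsContinuousOrientation (I := 𝓘(ℝ, Fin n → ℂ)) (M := ComplexPoints X) (fun _ ↦ o₀) ∧
          ∃ F : cclosedSmoothForms (Fin n → ℂ) (ComplexPoints X) (2 * d),
            cintegral (fun _ : ComplexPoints X ↦ o₀)
              (F : MForm 𝓘(ℝ, Fin n → ℂ) (ComplexPoints X) ℂ (2 * d)) ≠ 0 from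
    h (d := n) (by simp)
  intro d hd _
  subst hd
  obtain ⟨o₀, hcont, hpos⟩ :=
    exists_orientation_integral_kaehlerFormPow_pos (M := ComplexPoints X) g hg.isHermitian
  refine ⟨o₀, hcont, ⟨(kaehlerFormPow g.toRiemannianMetric (finrank ℂ (Fin n → ℂ))).ofReal,
    ofReal_mem_cclosedSmoothForms (kaehlerFormPow_mem_closedSmoothForms
      isSmoothForm_kaehlerForm_of_isManifold_complex_holds g hg _)⟩, ?_⟩
  change cintegral (fun _ : ComplexPoints X ↦ o₀)
    (kaehlerFormPow g.toRiemannianMetric (finrank ℂ (Fin n → ℂ))).ofReal ≠ 0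
  rw [Motives.cintegral_ofReal]
  exact_mod_cast hpos.ne'

end Literature.AlgebraicGeometry.HodgeTheory

end
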